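import Summits.SmoothPoincare4.SmoothPoincare4.Theorems.ConvexBisectionAcyclicBisectionExistsDualHandlePushTubeImage
import Summits.SmoothPoincare4.SmoothPoincare4.Theorems.ConvexBisectionAcyclicBisectionExistsDualHandleModelRegion
import HarnessLib

/-!
# The pushed prefix sub-handlebody, V: interior points are pushed into `{H > 0}`
(complement to brick (ii-2) "the global pushed embedding `jX₁' : X₁ → M'`" of the sub-goal T3b of
stub `stub_steinRealisation` (NF6), line `modp-braid-orbits` r11, crux
`ConvexBisection.AcyclicBisectionExists`, item stmt-SmoothPoincare4-10508; wave 4, lead c5,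
worker Y5)

Z3 landed the image of the punctured closed handle under the model push
(`image_modelPush_ball = pushTarget`, `pushTarget_eq : … = {‖x‖ ≤ 1, 0 ≤ H} ∖ C`) and the seam
(`modelH_modelPush_seam`: sphere points with `‖x_λ‖² < 3κ²/4` go onto `{H = 0}` strictly inside the
ball).  Here is the interior counterpart, which the consumer of the pushed embedding (Y6's
`{Φ ≥ 0} = range jX₁'`, `{Φ = 0} = jX₁'(∂X₁)`) needs to separate boundary from interior:

* `isOpen_image_modelPush` — `modelPush κ δ` is an open map on `{x_λ ≠ 0}` (a partial
  homeomorphism of `ℝ⁴` assembled from Z3's API);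
* `exists_neg_near_of_fderiv_ne_zero` — a differentiable function with nonzero derivative at a
  zero takes negative values in every neighbourhood;
* **`modelH_modelPush_pos`** — for `x_λ ≠ 0`, `‖x‖ < 1`: `0 < H (modelPush x)` and `‖modelPush x‖ < 1`
  (the image of the open punctured ball is an OPEN subset of `{‖·‖ ≤ 1, H ≥ 0}`, hence lies in the
  open ball, and misses `{H = 0}` because `0` is a regular value of `H` there, Z2's
  `fderiv_modelH_ne_zero`);
* **`modelH_selfPush_pos`** — tube form: for `‖y‖ < 1`, `y_λ ≠ 0`:
  `0 < H (α (selfPush κ δ y))` and `‖selfPush κ δ y‖ < 1`;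
* `helper_modelH_modelPush_pos` (registered).

Everything here is proved; no named facts, no definitions.

## References
* J. Milnor, *Lectures on the h-cobordism theorem* (1965), §3. [MilnorHCobordism1965]
* J. Milnor, *Morse theory* (1963), Thm. 3.1 (regular values). [Milnor1963]
-/

noncomputable section

-- the prescribed namespace `Summit.<P>.<Sub>.…` duplicates `SmoothPoincare4` (P = Sub)
set_option linter.dupNamespace false

open scoped Manifold ContDiff Topology

namespace Summit.SmoothPoincare4.SmoothPoincare4.Theorems.AcyclicBisectionExists.ModpBraidOrbits

open Set Function Metric Filter
open Literature.Topology.FourManifolds Literature.Topology.FourManifolds.HandleAttachingMap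

namespace PushModel

section Interior

variable {κ δ : ℝ}

/-- **`modelPush κ δ` is an open map on `{x_λ ≠ 0}`** (it is a partial homeomorphism of `ℝ⁴` with
source `{x_λ ≠ 0}`, target `pushInvDom κ δ`, inverse `modelPushInv κ δ`). [folklore] -/
theorem isOpen_image_modelPush (hκ : 0 < κ) (hκ2 : κ ≤ 1 / 2) (hδ : 0 < δ)
    {U : Set (EuclideanSpace ℝ (Fin 4))} (hU : IsOpen U) (hUs : U ⊆ {x | lamPart x ≠ 0}) :
    IsOpen (modelPush κ δ '' U) := by
  let Φ : OpenPartialHomeomorph (EuclideanSpace ℝ (Fin 4)) (EuclideanSpace ℝ (Fin 4)) :=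
    { toFun := modelPush κ δ
      invFun := modelPushInv κ δ
      source := {x | lamPart x ≠ 0}
      target := pushInvDom κ δ
      map_source' := fun x hx => mapsTo_modelPush hκ hκ2 hδ hx
      map_target' := fun x hx => mapsTo_modelPushInv hκ hx
      left_inv' := fun x hx => modelPushInv_modelPush hκ hκ2 hδ hx
      right_inv' := fun x hx => modelPush_modelPushInv hκ hκ2 hδ hx
      open_source := isOpen_ne.preimage contDiff_lamPart.continuous
      open_target := isOpen_pushInvDom hκ δ
      continuousOn_toFun := (contDiffOn_modelPush hκ hκ2 hδ).continuousOn
      continuousOn_invFun := (contDiffOn_modelPushInv hκ hκ2 hδ).continuousOn }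
  exact Φ.isOpen_image_of_subset_source hU hUs

/-- **A differentiable function with a nonzero derivative at a zero takes negative values in every
neighbourhood of that zero.** [cite: Milnor1963, Thm. 3.1] -/
theorem exists_neg_near_of_fderiv_ne_zero {f : EuclideanSpace ℝ (Fin 4) → ℝ} {z : EuclideanSpace ℝ (Fin 4)}
    (hf : DifferentiableAt ℝ f z) (h0 : f z = 0) (hD : fderiv ℝ f z ≠ 0) {V : Set (EuclideanSpace ℝ (Fin 4))}
    (hV : V ∈ 𝓝 z) : ∃ p ∈ V, f p < 0 := by
  -- a direction in which `f` decreases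
  obtain ⟨w, hw⟩ : ∃ w, fderiv ℝ f z w < 0 := by
    by_contra hcon
    push Not at hcon
    apply hD
    ext w
    have h1 := hcon w
    have h2 := hcon (-w)
    rw [map_neg] at h2
    show fderiv ℝ f z w = 0
    linarith
  -- the line `t ↦ f (z + t • w)`
  have hl : HasDerivAt (fun t : ℝ => z + t • w) w 0 := by
    simpa using ((hasDerivAt_id (0 : ℝ)).smul_const w).const_add z
  have hd : HasFDerivAt f (fderiv ℝ f z) (z + (0 : ℝ) • w) := by
    rw [zero_smul, add_zero]; exact hf.hasFDerivAt
  have hline : HasDerivAt (f ∘ fun t : ℝ => z + t • w) (fderiv ℝ f z w) 0 := hd.comp_hasDerivAt (0 : ℝ) hl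
  have hev : ∀ᶠ t : ℝ in 𝓝[>] 0, t⁻¹ • (f (z + (0 + t) • w) - f (z + (0 : ℝ) • w)) < 0 :=
    hline.tendsto_slope_zero_right (Iio_mem_nhds hw)
  have hcont : ∀ᶠ t : ℝ in 𝓝[>] 0, z + t • w ∈ V := by
    have hc : Continuous fun t : ℝ => z + t • w := by fun_prop
    have ht : Tendsto (fun t : ℝ => z + t • w) (𝓝 0) (𝓝 z) := by simpa using hc.tendsto 0
    exact (ht.mono_left nhdsWithin_le_nhds).eventually_mem hV
  obtain ⟨t, ⟨ht, htV⟩, htpos⟩ := ((hev.and hcont).and (self_mem_nhdsWithin : Ioi (0 : ℝ) ∈ 𝓝[>] 0)).exists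
  refine ⟨z + t • w, htV, ?_⟩
  have htpos' : (0 : ℝ) < t := htpos
  rw [zero_add, zero_smul, add_zero, h0, sub_zero, smul_eq_mul] at ht
  by_contra hge
  push Not at hge
  have : 0 ≤ t⁻¹ * f (z + t • w) := mul_nonneg (inv_nonneg.2 htpos'.le) hge
  linarith

/-- **INTERIOR POINTS ARE PUSHED INTO `{H > 0}` INSIDE THE OPEN BALL**: for `x_λ ≠ 0`, `‖x‖ < 1`:
`0 < modelH κ δ (modelPush κ δ x)` and `‖modelPush κ δ x‖ < 1`. [cite: MilnorHCobordism1965, §3] -/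
theorem modelH_modelPush_pos (hκ : 0 < κ) (hκ2 : κ ≤ 1 / 2) (hδ : 0 < δ) (hδ2 : δ ≤ 1 / 2)
    {x : EuclideanSpace ℝ (Fin 4)} (hx : lamPart x ≠ 0) (h1 : ‖x‖ < 1) :
    0 < modelH κ δ (modelPush κ δ x) ∧ ‖modelPush κ δ x‖ < 1 := by
  set U : Set (EuclideanSpace ℝ (Fin 4)) := {x | lamPart x ≠ 0 ∧ ‖x‖ < 1} with hU
  have hUo : IsOpen U :=
    (isOpen_ne.preimage contDiff_lamPart.continuous).inter (isOpen_lt continuous_norm continuous_const)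
  have hV : IsOpen (modelPush κ δ '' U) := isOpen_image_modelPush hκ hκ2 hδ hUo fun x hx => hx.1
  have hVsub : modelPush κ δ '' U ⊆ {z | ‖z‖ ≤ 1 ∧ 0 ≤ modelH κ δ z} := by
    rintro _ ⟨x', hx', rfl⟩
    have : modelPush κ δ x' ∈ pushTarget κ δ := by
      rw [← image_modelPush_ball hκ hκ2 hδ hδ2]
      exact ⟨x', ⟨hx'.1, hx'.2.le⟩, rfl⟩
    rw [pushTarget_eq hκ hκ2 hδ hδ2] at this
    exact this.1
  set z := modelPush κ δ x with hz
  have hzV : z ∈ modelPush κ δ '' U := ⟨x, ⟨hx, h1⟩, rfl⟩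
  have hz1 : ‖z‖ < 1 := by
    have hint : z ∈ interior (Metric.closedBall (0 : EuclideanSpace ℝ (Fin 4)) 1) :=
      interior_maximal (fun w hw => mem_closedBall_zero_iff.2 (hVsub hw).1) hV hzV
    rw [interior_closedBall _ one_ne_zero] at hint
    exact mem_ball_zero_iff.1 hint
  refine ⟨?_, hz1⟩
  rcases (hVsub hzV).2.lt_or_eq with h | h
  · exact h
  · exfalso
    have hD := fderiv_modelH_ne_zero hκ hδ (Or.inl hz1.le) h.symm
    obtain ⟨p, hpV, hp⟩ := exists_neg_near_of_fderiv_ne_zero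
      ((contDiff_modelH κ δ).differentiable (by simp)).differentiableAt h.symm hD (hV.mem_nhds hzV)
    exact absurd (hVsub hpV).2 (not_le.2 hp)

/-- **Tube form**: for an INTERIOR tube point `y` (`‖y‖ < 1`, `y_λ ≠ 0`) the pushed point read in
the handle chart lies in `{H > 0}`, and the push stays in the open ball:
`0 < modelH κ δ (α (selfPush κ δ y))`, `‖selfPush κ δ y‖ < 1`. [cite: MilnorHCobordism1965, §3] -/
theorem modelH_selfPush_pos (hκ : 0 < κ) (hκ2 : κ ≤ 1 / 2) (hδ : 0 < δ) (hδ2 : δ ≤ 1 / 2)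
    {y : EuclideanSpace ℝ (Fin 4)} (hy : ‖y‖ < 1) (h0 : lamPart y ≠ 0) :
    0 < modelH κ δ (handleInversion 2 (selfPush κ δ y)) ∧ ‖selfPush κ δ y‖ < 1 := by
  have hs0 : 0 < sOf y := sOf_pos_iff.2 h0
  have hs1 : sOf y < 1 := by
    have h := (norm_le_one_iff y).1 hy.le
    have hQ : 0 ≤ muN y := sq_nonneg _
    have hn : ‖y‖ ^ 2 = sOf y + muN y := by rw [sOf, muN, norm_sq_eq_lamPart_muPart]
    have h2 : ‖y‖ ^ 2 < 1 := pow_lt_one₀ (norm_nonneg y) hy two_ne_zero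
    linarith
  -- `α y` is an interior point with `(α y)_λ ≠ 0`
  have hαs : sOf (handleInversion 2 y) = 1 - sOf y := sOf_handleInversion hs0 hs1.le
  have hα0 : lamPart (handleInversion 2 y) ≠ 0 := sOf_pos_iff.1 (by rw [hαs]; linarith)
  have hα1 : ‖handleInversion 2 y‖ < 1 := by
    have hle := norm_handleInversion_le_one_sOf hy.le hs0 hs1
    refine lt_of_le_of_ne hle fun heq => ?_
    have := (norm_handleInversion_eq_one_iff hy.le (by rw [← sOf_eq_lamSq]; exact hs0)
      (by rw [← sOf_eq_lamSq]; exact hs1)).1 heq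
    linarith
  obtain ⟨hH, hn⟩ := modelH_modelPush_pos hκ hκ2 hδ hδ2 hα0 hα1
  rw [← handleInversion_selfPush hκ hκ2 hδ hs0 hs1] at hH hn
  refine ⟨hH, ?_⟩
  -- `‖α (S y)‖ < 1 ⇒ ‖S y‖ < 1`
  obtain ⟨hS1, hS0, hS1', -⟩ := selfPush_mem_of_lt hκ hκ2 hδ hδ2 hy.le hs0 hs1
  refine lt_of_le_of_ne hS1 fun heq => ?_
  have := (norm_handleInversion_eq_one_iff hS1 (by rw [← sOf_eq_lamSq]; exact hS0)
    (by rw [← sOf_eq_lamSq]; exact hS1')).2 heq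
  linarith

end Interior

end PushModel

/-- **Registered helper `helper_modelH_modelPush_pos` (complement to brick (ii-2) of T3b, sub-goal
of NF6 `stub_steinRealisation`, wave 4, lead c5): the model push sends interior points of the
punctured handle into `{H > 0}` inside the open ball, in handle and in tube coordinates.**
[cite: MilnorHCobordism1965, §3] -/
theorem helper_modelH_modelPush_pos : ∀ {κ δ : ℝ}, 0 < κ → κ ≤ 1 / 2 → 0 < δ → δ ≤ 1 / 2 → (∀ x : EuclideanSpace ℝ (Fin 4), Literature.Topology.FourManifolds.lamPart x ≠ 0 → ‖x‖ < 1 → 0 < Summit.SmoothPoincare4.SmoothPoincare4.Theorems.AcyclicBisectionExists.ModpBraidOrbits.modelH κ δ (Summit.SmoothPoincare4.SmoothPoincare4.Theorems.AcyclicBisectionExists.ModpBraidOrbits.PushModel.modelPush κ δ x) ∧ ‖Summit.SmoothPoincare4.SmoothPoincare4.Theorems.AcyclicBisectionExists.ModpBraidOrbits.PushModel.modelPush κ δ x‖ < 1) ∧ (∀ y : EuclideanSpace ℝ (Fin 4), ‖y‖ < 1 → Literature.Topology.FourManifolds.lamPart y ≠ 0 → 0 < Summit.SmoothPoincare4.SmoothPoincare4.Theorems.AcyclicBisectionExists.ModpBraidOrbits.modelH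 κ δ (Literature.Topology.FourManifolds.handleInversion 2 (Summit.SmoothPoincare4.SmoothPoincare4.Theorems.AcyclicBisectionExists.ModpBraidOrbits.PushModel.selfPush κ δ y)) ∧ ‖Summit.SmoothPoincare4.SmoothPoincare4.Theorems.AcyclicBisectionExists.ModpBraidOrbits.PushModel.selfPush κ δ y‖ < 1) := by
  intro κ δ hκ hκ2 hδ hδ2
  exact ⟨fun x hx h1 => PushModel.modelH_modelPush_pos hκ hκ2 hδ hδ2 hx h1,
    fun y hy h0 => PushModel.modelH_selfPush_pos hκ hκ2 hδ hδ2 hy h0⟩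

end Summit.SmoothPoincare4.SmoothPoincare4.Theorems.AcyclicBisectionExists.ModpBraidOrbits

end
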